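import Mathlib
import HarnessLib

/-! # Stub `helper_sublevelGrowthMonotone` of line `Sketch` (crux `EntropyRung.ConicalGap`, stmt-SmoothPoincare4-16589)

Pure real analysis (cycle 5, localisation to sublevel sets). Let `V : ℝ → ℝ` be monotone
(the volume profile `V t = Vol{f < t}` of the potential of a complete gradient shrinker) and put
`A t = ∫₀ᵗ V`. On a 4-d shrinker `t V(t) − 3 A(t) = ∫_{f<t} (1 + f − t) R ≤ 2 V(t)`, i.e. the
integral inequality `(t − 2) V(t) ≤ 3 A(t)` for all `t`. This file extracts its consequences:

* `Φ t = A t / (t − 2)³` is non-increasing on `(2, ∞)` (Cao–Zhou / Bishop type volume growth,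
  `A t ≤ A a ((t − 2)/(a − 2))³` for `2 < a ≤ t`);
* `V t ≤ 3 A(t)/(t − 2) ≤ 3 A(a) (t − 2)²/(a − 2)³` for `2 < a ≤ t`.

How. `A` is continuous (`Monotone.intervalIntegrable`, `intervalIntegral.continuous_primitive`)
and has at every `r` the RIGHT derivative `V(r⁺) = sInf (V '' Ioi r)` (`Monotone.tendsto_nhdsGT`
fed into `intervalIntegral.integral_hasDerivWithinAt_of_tendsto_ae_right`). Letting `s ↓ r` in
`(s − 2) V s ≤ 3 A s` gives `(r − 2) V(r⁺) ≤ 3 A r`, so the right derivative of `Φ` on `(2, ∞)` is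
`((r − 2) V(r⁺) − 3 A r)(r − 2)² / (r − 2)⁶ ≤ 0`, and the one-sided comparison principle
`image_le_of_deriv_right_le_deriv_boundary` (constant barrier `Φ a`) gives `Φ t ≤ Φ a` for
`a ≤ t`. The pointwise bound on `V t` is the hypothesis at `t` combined with `Φ t ≤ Φ a`.

Everything here is proved; no definition and no named fact is introduced.
-/

noncomputable section

set_option linter.dupNamespace false

open scoped Topology
open MeasureTheory Set Filter

namespace Summit.SmoothPoincare4.SmoothPoincare4.Theorems.ConicalGapSketch

/-- The primitive `u ↦ ∫₀ᵘ V` of a monotone function is continuous. -/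
theorem sublevelGrowth_continuous_primitive {V : ℝ → ℝ} (hV : Monotone V) :
    Continuous (fun u ↦ ∫ s in (0 : ℝ)..u, V s) :=
  intervalIntegral.continuous_primitive (fun _ _ ↦ hV.intervalIntegrable) 0

/-- The primitive `u ↦ ∫₀ᵘ V` of a monotone function has at every point `r` a right derivative,
equal to the right limit `V(r⁺) = sInf (V '' Ioi r)`. -/
theorem sublevelGrowth_hasDerivWithinAt_primitive {V : ℝ → ℝ} (hV : Monotone V) (r : ℝ) :
    HasDerivWithinAt (fun u ↦ ∫ s in (0 : ℝ)..u, V s) (sInf (V '' Ioi r)) (Ici r) r :=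
  intervalIntegral.integral_hasDerivWithinAt_of_tendsto_ae_right hV.intervalIntegrable
    hV.measurable.aestronglyMeasurable.stronglyMeasurableAtFilter
    ((hV.tendsto_nhdsGT r).mono_left inf_le_left)

/-- Limit form of the integral inequality: `(r − 2) V(r⁺) ≤ 3 A(r)` (let `s ↓ r` in
`(s − 2) V s ≤ 3 A s`, using the right limit of `V` and continuity of `A`). -/
theorem sublevelGrowth_limit_ineq {V : ℝ → ℝ} (hV : Monotone V)
    (hineq : ∀ t : ℝ, (t - 2) * V t ≤ 3 * ∫ s in (0 : ℝ)..t, V s) (r : ℝ) :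
    (r - 2) * sInf (V '' Ioi r) ≤ 3 * ∫ s in (0 : ℝ)..r, V s := by
  have h1 : Tendsto (fun t ↦ (t - 2) * V t) (𝓝[>] r) (𝓝 ((r - 2) * sInf (V '' Ioi r))) :=
    (((continuous_id.sub continuous_const).tendsto r).mono_left nhdsWithin_le_nhds).mul
      (hV.tendsto_nhdsGT r)
  have h2 : Tendsto (fun t ↦ 3 * ∫ s in (0 : ℝ)..t, V s) (𝓝[>] r)
      (𝓝 (3 * ∫ s in (0 : ℝ)..r, V s)) :=
    (((sublevelGrowth_continuous_primitive hV).tendsto r).mono_left nhdsWithin_le_nhds).const_mul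
      3
  exact le_of_tendsto_of_tendsto' h1 h2 fun t ↦ hineq t

/-- Monotonicity of `Φ t = A t / (t − 2)³` on `(2, ∞)` from the integral inequality
`(t − 2) V t ≤ 3 A t`, via the right derivative of `Φ` and the one-sided comparison principle. -/
theorem sublevelGrowth_antitoneOn {V : ℝ → ℝ} (hV : Monotone V)
    (hineq : ∀ t : ℝ, (t - 2) * V t ≤ 3 * ∫ s in (0 : ℝ)..t, V s) :
    AntitoneOn (fun t ↦ (∫ s in (0 : ℝ)..t, V s) / (t - 2) ^ 3) (Set.Ioi 2) := by
  intro a ha b _ hab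
  have ha2 : (2 : ℝ) < a := ha
  -- right derivative of `Φ` at `x > 2`
  have hderiv : ∀ x ∈ Ico a b, HasDerivWithinAt (fun t ↦ (∫ s in (0 : ℝ)..t, V s) / (t - 2) ^ 3)
      ((sInf (V '' Ioi x) * (x - 2) ^ 3 - (∫ s in (0 : ℝ)..x, V s) * (3 * (x - 2) ^ 2))
        / ((x - 2) ^ 3) ^ 2) (Ici x) x := by
    intro x hx
    have hx2 : (0 : ℝ) < x - 2 := by linarith [hx.1]
    have hD : HasDerivWithinAt (fun t : ℝ ↦ (t - 2) ^ 3) (3 * (x - 2) ^ 2) (Ici x) x := by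
      refine (((hasDerivAt_id' x).sub_const 2).pow 3).hasDerivWithinAt.congr_deriv ?_
      norm_num
    exact (sublevelGrowth_hasDerivWithinAt_primitive hV x).div hD (pow_pos hx2 3).ne'
  have hcont : ContinuousOn (fun t ↦ (∫ s in (0 : ℝ)..t, V s) / (t - 2) ^ 3) (Icc a b) := by
    refine (sublevelGrowth_continuous_primitive hV).continuousOn.div
      ((continuous_id.sub continuous_const).pow 3).continuousOn fun x hx ↦ ?_
    have hx2 : (0 : ℝ) < x - 2 := by linarith [hx.1]
    exact (pow_pos hx2 3).ne'
  have hbound : ∀ x ∈ Ico a b,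
      (sInf (V '' Ioi x) * (x - 2) ^ 3 - (∫ s in (0 : ℝ)..x, V s) * (3 * (x - 2) ^ 2))
        / ((x - 2) ^ 3) ^ 2 ≤ (0 : ℝ) := by
    intro x hx
    have hx2 : (0 : ℝ) < x - 2 := by linarith [hx.1]
    have hlim := sublevelGrowth_limit_ineq hV hineq x
    refine div_nonpos_of_nonpos_of_nonneg ?_ (by positivity)
    have : (sInf (V '' Ioi x) * (x - 2) ^ 3 - (∫ s in (0 : ℝ)..x, V s) * (3 * (x - 2) ^ 2))
        = ((x - 2) * sInf (V '' Ioi x) - 3 * ∫ s in (0 : ℝ)..x, V s) * (x - 2) ^ 2 := by ring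
    rw [this]
    exact mul_nonpos_of_nonpos_of_nonneg (by linarith) (by positivity)
  have key := image_le_of_deriv_right_le_deriv_boundary hcont hderiv
    (B := fun _ ↦ (∫ s in (0 : ℝ)..a, V s) / (a - 2) ^ 3) (B' := fun _ ↦ 0) le_rfl
    continuousOn_const (fun x _ ↦ hasDerivWithinAt_const x (Ici x) _) hbound
  exact key (right_mem_Icc.2 hab)

/-- **Stub `helper_sublevelGrowthMonotone`.** For a monotone nonnegative `V : ℝ → ℝ` with
`(t − 2) V t ≤ 3 ∫₀ᵗ V` for all `t`: the quotient `(∫₀ᵗ V) / (t − 2)³` is non-increasing on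
`(2, ∞)`, and `V t ≤ 3 (∫₀ᵃ V) (t − 2)² / (a − 2)³` whenever `2 < a ≤ t`. -/
theorem helper_sublevelGrowthMonotone : ∀ (V : ℝ → ℝ), Monotone V → (∀ t, 0 ≤ V t) → (∀ t : ℝ, (t - 2) * V t ≤ 3 * ∫ s in (0 : ℝ)..t, V s) → AntitoneOn (fun t ↦ (∫ s in (0 : ℝ)..t, V s) / (t - 2) ^ 3) (Set.Ioi 2) ∧ ∀ a t : ℝ, 2 < a → a ≤ t → V t ≤ 3 * (∫ s in (0 : ℝ)..a, V s) * (t - 2) ^ 2 / (a - 2) ^ 3 := by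
  intro V hV _ hineq
  have hanti := sublevelGrowth_antitoneOn hV hineq
  refine ⟨hanti, fun a t ha hat ↦ ?_⟩
  have ha2 : (0 : ℝ) < a - 2 := by linarith
  have ht2 : (0 : ℝ) < t - 2 := by linarith
  have h1 := hineq t
  have h2 : (∫ s in (0 : ℝ)..t, V s) / (t - 2) ^ 3 ≤ (∫ s in (0 : ℝ)..a, V s) / (a - 2) ^ 3 :=
    hanti (Set.mem_Ioi.2 (by linarith)) (Set.mem_Ioi.2 (by linarith)) hat
  rw [div_le_div_iff₀ (pow_pos ht2 3) (pow_pos ha2 3)] at h2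
  rw [le_div_iff₀ (pow_pos ha2 3)]
  have h1' : (t - 2) * V t * (a - 2) ^ 3 ≤ 3 * (∫ s in (0 : ℝ)..t, V s) * (a - 2) ^ 3 :=
    mul_le_mul_of_nonneg_right h1 (pow_pos ha2 3).le
  have h3 : (t - 2) * (V t * (a - 2) ^ 3)
      ≤ (t - 2) * (3 * (∫ s in (0 : ℝ)..a, V s) * (t - 2) ^ 2) := by
    nlinarith [h1', h2]
  exact le_of_mul_le_mul_left h3 ht2

end Summit.SmoothPoincare4.SmoothPoincare4.Theorems.ConicalGapSketch

end
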